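import Summits.FinalStateConjecture.FinalStateConjecture.Theorems.SwallowTheDatumParametricKerrBurialLine
import Literature.Geometry.Lorentzian.InitialDataPullback
import Literature.Geometry.Lorentzian.InitialDataDilation
import Literature.Geometry.Lorentzian.AFEndTransport
import Mathlib.Analysis.InnerProductSpace.Spectrum

/-!
# Route `SwallowTheDatum` · item `BurialIntoShieldedBackground` (stmt-FinalStateConjecture-14721) —
# cone certificates, covariance of the shield and of the admissible class, frames

The item reads `KerrShieldedDataExist → ParametricKerrBurial` (route file, rev 8): given ONE admissible
Kerr-shielded background `B` on `ℝ³`, every admissible datum on every `X` is parametrically Kerr-buried.  Its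
full content is the parametric gluing engine of the crux `ParametricKerrBurial` (stmt-FinalStateConjecture-10052;
Hintz 2022 Thm. 1.1/5.2, Mao–Oh–Tao 2023) with the background factored out — not available in the tree.  This
file lands, sorry-free and definition-free, the parts of the item's intended proof (route file: "(iii) rescale …,
transport to the fixed `X` by diffeomorphisms, … injectivity") that need no PDE, and on which the companion file
`SwallowTheDatumBurialIntoShieldedBackgroundFlat.lean` builds the RELATIVE BURIAL OF THE FLAT DATUM
(`KerrShieldedDataExist ⇒` the conclusion of `ParametricKerrBurial` at the flat datum of `ℝ³`):

* §1 CONE CERTIFICATES — the item follows from the crux by weakening (`of_parametricKerrBurial`) and, with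
  `KerrShieldedDataExist`, gives it back (`parametricKerrBurial_of`); both decls unfold (`Iff.rfl`) to the
  route's vocabulary `IsKerrShielded` of `Theorems/SwallowTheDatumParametricKerrBurialLine.lean`;
* §2 DIFFEOMORPHISM COVARIANCE OF THE SHIELD (`isKerrShielded_comap`): `Θ^* D` is shielded through `Θ⁻¹ ∘ φ`;
* §3 DIFFEOMORPHISM INVARIANCE OF THE ADMISSIBLE CLASS (`comap_mem_admissibleVacuumData`): constraints are
  natural, completeness is an isometry invariant, the sole DR-flat end is transported (`AFEnd.comap`);
* §4 FRAMES (`exists_frame`): a positive definite symmetric bilinear form on `ℝ³` is Euclidean in some linear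
  frame (spectral theorem) — used to normalise the background's metric at the blow-up point;
* §5 linear pullbacks on `ℝ³` in the coordinate readings `coordH`/`coordK`, and
  `comap_linear_mem_and_shielded`.

References: route file `Theses/SwallowTheDatum.lean` (items 14721, 10052, 10055); O'Neill 1983, Ch. 3, p. 58 and
Cor. 3.61; Bartnik–Isenberg 2004, §2; Christodoulou 1999, p. A24.
-/

-- `Summit.<Summit>.<Problem>` is the tree's mandated summit-side namespace (CONVENTIONS §2); for this
-- single-conjunct summit the two coincide, so the duplicate is deliberate.
set_option linter.dupNamespace false

noncomputable section

namespace Summit.FinalStateConjecture.FinalStateConjecture.Theorems.SwallowTheDatum.BurialIntoShieldedBackground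

open scoped Manifold ContDiff Topology InnerProductSpace
open Bundle Set Function Literature.Geometry.Lorentzian
open Summit.FinalStateConjecture.FinalStateConjecture.Theses.SwallowTheDatum
  (ParametricKerrBurial KerrShieldedDataExist BurialIntoShieldedBackground)
open Summit.FinalStateConjecture.FinalStateConjecture.Theorems.SwallowTheDatum.ParametricKerrBurial
  (IsKerrShielded)

/-! ## §1 Cone certificates -/

/-- **The item follows from the crux** `ParametricKerrBurial` (weakening: the background hypothesis is
simply not used). Route file, item 14721 ("Logic: ParametricKerrBurial ⇒ this item (fun _ ↦ h)"). [folklore] -/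
theorem of_parametricKerrBurial (h : ParametricKerrBurial) : BurialIntoShieldedBackground :=
  fun _ ↦ h

/-- **The item and the background give the crux back** (modus ponens): `KerrShieldedDataExist ∧ item ⇒
ParametricKerrBurial` — the cone `KerrShieldedDataExist → ParametricKerrBurial → WitnessFamilyOfCruxes →
UniversalWitnessFamily → closes` of the route repair of 2026-08-16. [folklore] -/
theorem parametricKerrBurial_of (h : BurialIntoShieldedBackground) (hB : KerrShieldedDataExist) :
    ParametricKerrBurial :=
  h hB

/-- **The background hypothesis in the route's vocabulary**: `KerrShieldedDataExist` is, definitionally,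
"some admissible datum on `ℝ³` is `IsKerrShielded`" (the shielding predicate isolated verbatim in
`Theorems/SwallowTheDatumParametricKerrBurialLine.lean`; the hard-coded height is `bentHeight M a` by
`bentHeight_eq_literal : … := rfl`). [folklore] -/
theorem kerrShieldedDataExist_iff :
    KerrShieldedDataExist ↔ ∀ [Kerr.Facts], ∃ D ∈ admissibleVacuumData E3, IsKerrShielded E3 D :=
  Iff.rfl

/-- **The item, unfolded** (`Iff.rfl`): one admissible `IsKerrShielded` datum on `ℝ³` implies that
through every admissible datum on every `X` passes a smooth injective admissible one-parameter family
whose members off `c = 0` are `IsKerrShielded`. [folklore] -/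
theorem iff_unfolded :
    BurialIntoShieldedBackground ↔
      ((∀ [Kerr.Facts], ∃ D ∈ admissibleVacuumData E3, IsKerrShielded E3 D) →
        ∀ [Kerr.Facts] (X : Type) [TopologicalSpace X] [ChartedSpace E3 X]
          [IsManifold (𝓡 3) ∞ X] [T2Space X] [SecondCountableTopology X] [ConnectedSpace X],
          ∀ d ∈ admissibleVacuumData X,
            ∃ F : EuclideanSpace ℝ (Fin 1) → InitialDataSet (𝓡 3) X,
              InitialDataSet.IsSmoothDataFamily 1 F ∧ F 0 = d ∧ Function.Injective F ∧
                (∀ c, F c ∈ admissibleVacuumData X) ∧ ∀ c ≠ 0, IsKerrShielded X (F c)) :=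
  Iff.rfl

/-! ## §2 Diffeomorphism covariance of the shielding predicate -/

section Comap

variable [Kerr.Facts] {X Y : Type} [TopologicalSpace X] [ChartedSpace E3 X] [IsManifold (𝓡 3) ∞ X]
  [TopologicalSpace Y] [ChartedSpace E3 Y] [IsManifold (𝓡 3) ∞ Y]

/-- **Diffeomorphism covariance of `IsKerrShielded`.** Let `Θ : Y ≅ X` be a diffeomorphism and `D` a datum
on `X` which is Kerr-shielded through `(M, a, r₁, T, φ, ψ, ν)`.  Then the pulled-back datum
`Θ^* D = (Θ^* h, Θ^* k)` on `Y` is Kerr-shielded through `(M, a, r₁, T, Θ⁻¹ ∘ φ, ψ, ν)`: the complement of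
the range of `Θ⁻¹ ∘ φ` is the `Θ⁻¹`-image of the (compact) complement of the range of `φ`; `Θ⁻¹ ∘ φ` is a
smooth open embedding; and `(Θ⁻¹ ∘ φ)^* (Θ^* h) = (Θ ∘ Θ⁻¹ ∘ φ)^* h = φ^* h = ψ^* g_{M,a}` by the chain rule
for pullbacks (`pullbackBilin_comp`), likewise for `k` against the second fundamental form.  The graph,
spacelikeness and unit-normal clauses do not mention the datum.  O'Neill 1983, Ch. 3, p. 58;
Bartnik–Isenberg 2004, §2. [folklore] -/
theorem isKerrShielded_comap (Θ : Diffeomorph (𝓡 3) (𝓡 3) Y X ∞)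
    (hΘ : ContMDiff (𝓡 3) (𝓡 3) (∞ + 1) Θ) (hΘ' : ∀ u, Injective (mfderiv (𝓡 3) (𝓡 3) Θ u))
    {D : InitialDataSet (𝓡 3) X} (hD : IsKerrShielded X D) :
    IsKerrShielded Y (D.comap Θ hΘ hΘ') := by
  obtain ⟨M, a, r₁, hM, T, φ, ψ, ν, haM, hr₁, hr₂, hT, hK, hφ, hφs, hψ, hsp, hfun, hh, hk⟩ := hD
  set φ' : Kerr.slice a r₁ → Y := Θ.symm ∘ φ with hφ'
  have hφ's : ContMDiff 𝓘(ℝ, E3) (𝓡 3) ∞ φ' := Θ.symm.contMDiff.comp hφs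
  have hΘd : MDifferentiable (𝓡 3) (𝓡 3) Θ := Θ.contMDiff.mdifferentiable (by simp)
  have hφ'd : MDifferentiable 𝓘(ℝ, E3) (𝓡 3) φ' := hφ's.mdifferentiable (by simp)
  have hcomp : (Θ : Y → X) ∘ φ' = φ := by
    funext y
    simp [hφ']
  refine ⟨M, a, r₁, hM, T, φ', ψ, ν, haM, hr₁, hr₂, hT, ?_, ?_, hφ's, hψ, hsp, hfun, ?_, ?_⟩
  · -- compact complement of the range
    have hr : (Set.range φ')ᶜ = Θ.symm '' (Set.range φ)ᶜ := by
      rw [hφ', Set.range_comp]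
      exact (Set.image_compl_eq (f := (Θ.symm : X → Y)) Θ.symm.toEquiv.bijective).symm
    rw [hr]
    exact hK.image Θ.symm.continuous
  · -- open embedding
    exact Θ.symm.toHomeomorph.isOpenEmbedding.comp hφ
  · -- the metric clause
    intro y
    have h1 : (D.comap Θ hΘ hΘ').h.inner = pullbackBilin (I := 𝓡 3) (I' := 𝓡 3) Θ D.h.inner := by
      funext u
      ext v w
      rfl
    rw [h1, ← congrFun (pullbackBilin_comp (I := 𝓡 3) (I' := 𝓘(ℝ, E3)) (I'' := 𝓡 3) hΘd hφ'd
      D.h.inner) y, hcomp]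
    exact hh y
  · -- the second-fundamental-form clause
    intro _ y
    have h1 : (D.comap Θ hΘ hΘ').k = pullbackBilin (I := 𝓡 3) (I' := 𝓡 3) Θ D.k := rfl
    rw [h1, ← congrFun (pullbackBilin_comp (I := 𝓡 3) (I' := 𝓘(ℝ, E3)) (I'' := 𝓡 3) hΘd hφ'd
      D.k) y, hcomp]
    exact hk y

end Comap

/-! ## §3 Transport of the admissible class along diffeomorphisms -/

section Transport

variable {X Y : Type} [TopologicalSpace X] [ChartedSpace E3 X] [IsManifold (𝓡 3) ∞ X]
  [TopologicalSpace Y] [ChartedSpace E3 Y] [IsManifold (𝓡 3) ∞ Y]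

/-- **Christodoulou's admissible class is diffeomorphism invariant**: for a diffeomorphism `Θ : Y ≅ X`
and `D ∈ 𝓓(X)`, the pulled-back datum `Θ^* D` lies in `𝓓(Y)` — the constraints are natural
(`isVacuumConstraintSolution_comap'`), `Θ` is an isometry `(Y, Θ^* h) → (X, h)` so completeness
transports (`IsIsometry.isGeodesicallyComplete`), and the sole strongly asymptotically flat end is carried
along `Θ` with its coefficients verbatim (`AFEnd.comap`, `isSoleEnd_comap`,
`isStronglyAsymptoticallyFlatDR_comap`). Christodoulou 1999, p. A24; Bartnik–Isenberg 2004, §2. [folklore] -/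
theorem comap_mem_admissibleVacuumData (Θ : Diffeomorph (𝓡 3) (𝓡 3) Y X ∞)
    (hΘ : ContMDiff (𝓡 3) (𝓡 3) (∞ + 1) Θ) (hΘ' : ∀ u, Injective (mfderiv (𝓡 3) (𝓡 3) Θ u))
    {D : InitialDataSet (𝓡 3) X} (hD : D ∈ admissibleVacuumData X) :
    D.comap Θ hΘ hΘ' ∈ admissibleVacuumData Y := by
  obtain ⟨hvc, e, M, hsole, hSAF⟩ := hD
  haveI := D.metric.hasLeviCivita
  refine ⟨fun {_} ↦ ⟨D.isVacuumConstraintSolution_comap' hΘ hΘ' hvc.1, ?_⟩, e.comap Θ, M,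
    e.isSoleEnd_comap Θ hsole, e.isStronglyAsymptoticallyFlatDR_comap Θ D hΘ hΘ' hSAF⟩
  have hiso : PseudoRiemannianMetric.IsIsometry
      (PseudoRiemannianMetric.ofRiemannian (D.comap Θ hΘ hΘ').h)
      (PseudoRiemannianMetric.ofRiemannian D.h) Θ := fun _ ↦ rfl
  haveI : (PseudoRiemannianMetric.ofRiemannian (D.comap Θ hΘ hΘ').h).HasLeviCivita := ‹_›
  haveI : (PseudoRiemannianMetric.ofRiemannian D.h).HasLeviCivita := ‹D.metric.HasLeviCivita›
  exact hiso.isGeodesicallyComplete rfl hvc.2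

end Transport

/-! ## §4 A frame orthonormalising a positive definite form -/

/-- **Linear algebra: every positive definite symmetric bilinear form `β` on `ℝ³` is the Euclidean form in
some linear frame**: there is a linear automorphism `A` with `β(A v, A w) = ⟪v, w⟫`.  Proof: `β = ⟪T ·, ·⟫`
for a symmetric operator `T` (Riesz), diagonalised by an orthonormal eigenbasis `b` with eigenvalues
`λᵢ = β(bᵢ, bᵢ) > 0` (spectral theorem, `LinearMap.IsSymmetric.eigenvectorBasis`); take
`A = T^{-1/2} = ∑ λᵢ^{-1/2} ⟪bᵢ, ·⟫ bᵢ`. [folklore] -/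
theorem exists_frame (β : E3 →L[ℝ] E3 →L[ℝ] ℝ) (hsymm : ∀ v w, β v w = β w v)
    (hpos : ∀ v, v ≠ 0 → 0 < β v v) :
    ∃ A : E3 ≃L[ℝ] E3, ∀ v w, β (A v) (A w) = ⟪v, w⟫_ℝ := by
  -- the symmetric operator `T` with `⟪T v, w⟫ = β v w`
  let T : E3 →ₗ[ℝ] E3 :=
    { toFun := fun v ↦ (InnerProductSpace.toDual ℝ E3).symm (β v)
      map_add' := fun v w ↦ by simp [map_add]
      map_smul' := fun c v ↦ by simp [map_smul] }
  have hT : ∀ v w, ⟪T v, w⟫_ℝ = β v w := fun v w ↦ by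
    simp [T, InnerProductSpace.toDual_symm_apply]
  have hTs : T.IsSymmetric := fun v w ↦ by
    rw [hT, hsymm, ← hT, real_inner_comm]
  have hn : Module.finrank ℝ E3 = 3 := by simp
  set b := hTs.eigenvectorBasis hn with hb
  set ev := hTs.eigenvalues hn with hev
  have happly : ∀ i, T (b i) = ev i • b i := fun i ↦ by
    simp [hb, hev, hTs.apply_eigenvectorBasis hn i]
  have hev_pos : ∀ i, 0 < ev i := fun i ↦ by
    have h1 : β (b i) (b i) = ev i := by
      rw [← hT, happly, real_inner_smul_left, real_inner_self_eq_norm_sq, b.orthonormal.1 i]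
      ring
    have h2 : b i ≠ 0 := b.orthonormal.ne_zero i
    linarith [hpos (b i) h2, h1]
  -- the frame `A = T^{-1/2}` in the eigenbasis
  let A : E3 →L[ℝ] E3 := ∑ i, (Real.sqrt (ev i))⁻¹ • (innerSL ℝ (b i)).smulRight (b i)
  have hA : ∀ v, A v = ∑ i, ((Real.sqrt (ev i))⁻¹ * ⟪b i, v⟫_ℝ) • b i := fun v ↦ by
    simp [A, ContinuousLinearMap.smulRight_apply, smul_smul]
  have hs0 : ∀ i, Real.sqrt (ev i) ≠ 0 := fun i ↦ (Real.sqrt_pos.2 (hev_pos i)).ne'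
  have hTA : ∀ v, T (A v) = ∑ i, (Real.sqrt (ev i) * ⟪b i, v⟫_ℝ) • b i := fun v ↦ by
    rw [hA, map_sum]
    refine Finset.sum_congr rfl fun i _ ↦ ?_
    rw [map_smul, happly, smul_smul]
    congr 1
    field_simp [hs0 i]
    rw [Real.sq_sqrt (hev_pos i).le]
    ring
  have hinner_b : ∀ (c : Fin 3 → ℝ) (j : Fin 3), ⟪∑ i, c i • b i, b j⟫_ℝ = c j := fun c j ↦ by
    rw [sum_inner]
    simp_rw [real_inner_smul_left]
    have : ∀ i, c i * ⟪b i, b j⟫_ℝ = if i = j then c j else 0 := fun i ↦ by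
      rw [orthonormal_iff_ite.1 b.orthonormal i j]
      split_ifs with h
      · subst h; ring
      · ring
    simp_rw [this]
    simp
  have hβA : ∀ v w, β (A v) (A w) = ⟪v, w⟫_ℝ := fun v w ↦ by
    rw [← hT, hTA, hA w, inner_sum, ← b.sum_inner_mul_inner v w]
    refine Finset.sum_congr rfl fun j _ ↦ ?_
    rw [real_inner_smul_right, hinner_b (fun i ↦ Real.sqrt (ev i) * ⟪b i, v⟫_ℝ) j,
      real_inner_comm (b j) v]
    field_simp [hs0 j]
  -- `A` is injective (`β(A v, A v) = ‖v‖²`), hence a linear automorphism of `ℝ³`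
  have hAinj : Function.Injective A := by
    intro v w hvw
    have h0 : ⟪v - w, v - w⟫_ℝ = 0 := by
      rw [← hβA, map_sub, hvw, sub_self]
      simp
    exact sub_eq_zero.1 (inner_self_eq_zero.1 h0)
  exact ⟨(LinearMap.linearEquivOfInjective (A : E3 →ₗ[ℝ] E3) hAinj rfl).toContinuousLinearEquiv,
    fun v w ↦ hβA v w⟩

/-! ## §5 Pullbacks along linear automorphisms of `ℝ³` -/

section Linear

variable (A : E3 ≃L[ℝ] E3)

/-- A linear automorphism of `ℝ³` is smooth. [folklore] -/
theorem contMDiff_linear : ContMDiff (𝓡 3) (𝓡 3) (∞ + 1) (A : E3 → E3) :=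
  (A : E3 →L[ℝ] E3).contDiff.contMDiff

/-- The differential of a linear automorphism of `ℝ³` is injective (it is the map itself). [folklore] -/
theorem injective_mfderiv_linear (y : E3) : Injective (mfderiv (𝓡 3) (𝓡 3) (A : E3 → E3) y) := by
  rw [show (A : E3 → E3) = ((A : E3 →L[ℝ] E3) : E3 → E3) from rfl, ContinuousLinearMap.mfderiv_eq]
  exact A.injective

/-- The differential of a linear automorphism of `ℝ³`, applied. [folklore] -/
theorem mfderiv_linear_apply (y v : E3) : mfderiv (𝓡 3) (𝓡 3) (A : E3 → E3) y v = A v := by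
  rw [show (A : E3 → E3) = ((A : E3 →L[ℝ] E3) : E3 → E3) from rfl, ContinuousLinearMap.mfderiv_eq]
  rfl

/-- The pullback `A^* C` of data on `ℝ³` along the linear automorphism `A`, in the coordinate reading
`coordH`: `h'(y)(v, w) = h(A y)(A v, A w)`. [folklore] -/
theorem coordH_comap_linear (C : InitialDataSet (𝓡 3) E3) (y v w : E3) :
    (C.comap A (contMDiff_linear A) (injective_mfderiv_linear A)).coordH y v w =
      C.coordH (A y) (A v) (A w) := by
  rw [InitialDataSet.coordH_apply, InitialDataSet.coordH_apply, InitialDataSet.comap_h_inner,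
    mfderiv_linear_apply, mfderiv_linear_apply]

/-- The pullback `A^* C` of data on `ℝ³` along the linear automorphism `A`, in the coordinate reading
`coordK`: `k'(y)(v, w) = k(A y)(A v, A w)`. [folklore] -/
theorem coordK_comap_linear (C : InitialDataSet (𝓡 3) E3) (y v w : E3) :
    (C.comap A (contMDiff_linear A) (injective_mfderiv_linear A)).coordK y v w =
      C.coordK (A y) (A v) (A w) := by
  rw [InitialDataSet.coordK_apply, InitialDataSet.coordK_apply, InitialDataSet.comap_k,
    mfderiv_linear_apply, mfderiv_linear_apply]

variable [Kerr.Facts]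

/-- **Pullbacks of admissible shielded data along linear automorphisms are admissible and shielded.**
[folklore] -/
theorem comap_linear_mem_and_shielded {C : InitialDataSet (𝓡 3) E3} (hC : C ∈ admissibleVacuumData E3)
    (hCs : IsKerrShielded E3 C) :
    C.comap A (contMDiff_linear A) (injective_mfderiv_linear A) ∈ admissibleVacuumData E3 ∧
      IsKerrShielded E3 (C.comap A (contMDiff_linear A) (injective_mfderiv_linear A)) :=
  ⟨comap_mem_admissibleVacuumData A.toDiffeomorph (contMDiff_linear A) (injective_mfderiv_linear A) hC,
    isKerrShielded_comap A.toDiffeomorph (contMDiff_linear A) (injective_mfderiv_linear A) hCs⟩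

end Linear


end Summit.FinalStateConjecture.FinalStateConjecture.Theorems.SwallowTheDatum.BurialIntoShieldedBackground

end
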